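import Mathlib
import Summits.Ventures.PercRepro2.V2SP
import Summits.Ventures.PercRepro2.Tail2DDisjointPaths
import Summits.Ventures.PercRepro2.Tail2DP2SeriesSP
import Summits.Ventures.PercRepro2.Tail2DStepRowZero
import Summits.Ventures.PercRepro2.Tail2DUnitStep

/-!
# The row `i = 0` of the unit-STEP family on every series–parallel network: `Σ_{r = 0 ∧ b ≥ j} b ≤ #{r = 1 ∧ b ≥ j−1}`
for EVERY `j`, hence the quantitative row zero `j·#{r = 0 ∧ b ≥ j} ≤ #{r = 1 ∧ b ≥ j−1}`
(seat mine-b, cell pub-perc-repro2; MINE-B.md §39.16)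

The unit-STEP member `(US)(0,j)` (`Tail2DUnitStep.lean`) counts the blue units (the blue flow) of the configurations
with no red path and at least `j` blue paths against the configurations with exactly one red path and at least `j−1`
blue paths.  Its row `i = 0` is a theorem on every pattern of the grammar for EVERY `j ≥ 0` (`unitStep_row_zero`):
the member `j = 0` is the lane's count `(U′)` of `V2SP.lean` (`SP.sum_nu'_nonneg`, after the colour swap:
`Σ_{b = 0} r = Σ_{b = 0, r ≥ 2} r + #{b = 0, r = 1} ≤ #{r = 1, b ≥ 1} + #{r = 1, b = 0} = #{r = 1}`); the member
`j = 1` is the member `j = 2` by the offset-one identity; the series step is `unitStep_ser` with the axis theorem and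
the row `j = 1` of the tails; the PARALLEL step is an exact slice identity with no unsigned term: the blue units of a
source `(x, y)` split as `b_x + b_y`, the units of `x` pair, for every fixed `y` with `r_y = 0`, with the targets
`(x′, y)`, `r_{x′} = 1`, through `(US)(0, j − b_y)` of the first factor — a member of the same row at a lower level,
including the level `0` — and symmetrically (`unitCount_par_zero_le`).  COROLLARY `qstep_row_zero`:
`j · #{r = 0 ∧ b ≥ j} ≤ #{r = 1 ∧ b ≥ j−1}` — the row `i = 0` of STEP (`step_row_zero`, §37.6) strengthened by
the factor `j`, tight on every bundle (`j · C(n,0)·[n ≥ j] = C(n,1)·[n−1 ≥ j−1]` when `n = j`).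
-/

namespace Summit.Ventures.PercRepro2.Tail2D

open V2Closure

section Zero

variable (s : V2Closure.SP)

/-- a weighted sum over configurations is invariant under the colour swap -/
lemma sum_swap_fun (f : ℕ → ℕ → ℕ) : ∑ x, f (s.rLab x) (s.bLab x) = ∑ x, f (s.bLab x) (s.rLab x) := by
  refine Finset.sum_nbij' (swapConf s) (swapConf s) (fun _ _ => Finset.mem_univ _) (fun _ _ => Finset.mem_univ _)
    (fun x _ => swapConf_swapConf s x) (fun x _ => swapConf_swapConf s x) (fun x _ => ?_)
  rw [rLab_swapConf, bLab_swapConf]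

/-- **the member `j = 0`**: `Σ_{r = 0} b ≤ #{r = 1}` — the lane's count `(U′)` after the colour swap -/
theorem unitStep_zero_zero : UnitStep s 0 0 := by
  unfold UnitStep unitCount
  have hU := SP.sum_nu'_nonneg s
  -- `Σ_{r = 0} b = Σ_{b = 0} r` (the swap), split by `r = 1` / `r ≥ 2`
  have e1 : (∑ x, if s.rLab x = 0 ∧ 0 ≤ s.bLab x then s.bLab x else 0)
      = ∑ x, if s.bLab x = 0 ∧ 0 ≤ s.rLab x then s.rLab x else 0 :=
    sum_swap_fun s (fun r b => if r = 0 ∧ 0 ≤ b then b else 0)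
  rw [e1]
  -- the count of `ν′` in ℤ: `#{r = 1 ∧ b ≥ 1} − Σ_{b = 0 ∧ r ≥ 2} r ≥ 0`
  have e2 : ∑ x, nu' s.rLab s.bLab x
      = ((∑ x, if s.rLab x = 1 ∧ 1 ≤ s.bLab x then (1 : ℕ) else 0 : ℕ) : ℤ)
        - ((∑ x, if s.bLab x = 0 ∧ 2 ≤ s.rLab x then s.rLab x else 0 : ℕ) : ℤ) := by
    push_cast
    rw [← Finset.sum_sub_distrib]
    refine Finset.sum_congr rfl (fun x _ => ?_)
    unfold nu'
    split_ifs <;> simp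
  have e3 : ((Finset.univ.filter (fun y : s.Conf => s.rLab y = 0 + 1 ∧ 0 - 1 ≤ s.bLab y)).card : ℕ)
      = (∑ x, if s.rLab x = 1 ∧ 1 ≤ s.bLab x then (1 : ℕ) else 0) + (∑ x, if s.bLab x = 0 ∧ s.rLab x = 1 then (1 : ℕ) else 0) := by
    rw [Finset.card_filter, ← Finset.sum_add_distrib]
    refine Finset.sum_congr rfl (fun x _ => ?_)
    split_ifs <;> omega
  have e4 : (∑ x, if s.bLab x = 0 ∧ 0 ≤ s.rLab x then s.rLab x else 0)
      = (∑ x, if s.bLab x = 0 ∧ 2 ≤ s.rLab x then s.rLab x else 0) + (∑ x, if s.bLab x = 0 ∧ s.rLab x = 1 then (1 : ℕ) else 0) := by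
    rw [← Finset.sum_add_distrib]
    refine Finset.sum_congr rfl (fun x _ => ?_)
    split_ifs <;> omega
  rw [e2] at hU
  rw [e3, e4, Nat.zero_add, one_mul]
  omega

end Zero

section Parallel

variable (s t : V2Closure.SP)

/-- **the parallel step of the row `i = 0`** (every `j`): `(US)(0, l)` at every level `l ≤ j` on both factors gives
`(US)(0, j)` on the parallel composition — the blue units of a source split between the factors, and for each
`y` with `r_y = 0` the units of `x` are paid by `(US)(0, j − b_y)` of the first factor -/
theorem unitCount_par_zero_le (j : ℕ)
    (hs : ∀ l, l ≤ j → UnitStep s 0 l) (ht : ∀ l, l ≤ j → UnitStep t 0 l) :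
    UnitStep (V2Closure.SP.par s t) 0 j := by
  unfold UnitStep
  rw [Nat.zero_add, one_mul]
  -- the composite unit count and target count as sums over the product of the configuration spaces
  have hU : unitCount (V2Closure.SP.par s t) 0 j
      = ∑ p : s.Conf × t.Conf, ((if t.rLab p.2 = 0 then (if s.rLab p.1 = 0 ∧ j - t.bLab p.2 ≤ s.bLab p.1 then s.bLab p.1 else 0) else 0)
          + (if s.rLab p.1 = 0 then (if t.rLab p.2 = 0 ∧ j - s.bLab p.1 ≤ t.bLab p.2 then t.bLab p.2 else 0) else 0)) := by
    unfold unitCount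
    refine Finset.sum_congr rfl (fun p _ => ?_)
    simp only [SP.rLab, SP.bLab, parR, parB]
    split_ifs <;> omega
  have hH : (Finset.univ.filter (fun y : (V2Closure.SP.par s t).Conf =>
        (V2Closure.SP.par s t).rLab y = 1 ∧ j - 1 ≤ (V2Closure.SP.par s t).bLab y)).card
      = ∑ p : s.Conf × t.Conf, (if s.rLab p.1 + t.rLab p.2 = 1 ∧ j - 1 ≤ s.bLab p.1 + t.bLab p.2 then 1 else 0) := by
    rw [Finset.card_filter]
    refine Finset.sum_congr rfl (fun p _ => ?_)
    simp only [SP.rLab, SP.bLab, parR, parB]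
    split_ifs <;> omega
  rw [hU, hH, Finset.sum_add_distrib]
  -- the first part: sum over `y`, then the inner sum is `[r_y = 0] · unitCount s 0 (j − b_y)`
  have h1 : (∑ p : s.Conf × t.Conf, if t.rLab p.2 = 0 then (if s.rLab p.1 = 0 ∧ j - t.bLab p.2 ≤ s.bLab p.1 then s.bLab p.1 else 0) else 0)
      ≤ ∑ p : s.Conf × t.Conf, if t.rLab p.2 = 0 ∧ s.rLab p.1 = 1 ∧ (j - t.bLab p.2) - 1 ≤ s.bLab p.1 then 1 else 0 := by
    rw [Fintype.sum_prod_type, Fintype.sum_prod_type]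
    conv_lhs => rw [Finset.sum_comm]
    conv_rhs => rw [Finset.sum_comm]
    refine Finset.sum_le_sum (fun y _ => ?_)
    by_cases hy : t.rLab y = 0
    · simp only [hy, if_true, true_and]
      have := hs (j - t.bLab y) (by omega)
      unfold UnitStep unitCount at this
      rw [Nat.zero_add, one_mul, Finset.card_filter] at this
      exact this
    · simp only [hy, if_false, false_and, Finset.sum_const_zero, le_refl]
  have h2 : (∑ p : s.Conf × t.Conf, if s.rLab p.1 = 0 then (if t.rLab p.2 = 0 ∧ j - s.bLab p.1 ≤ t.bLab p.2 then t.bLab p.2 else 0) else 0)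
      ≤ ∑ p : s.Conf × t.Conf, if s.rLab p.1 = 0 ∧ t.rLab p.2 = 1 ∧ (j - s.bLab p.1) - 1 ≤ t.bLab p.2 then 1 else 0 := by
    rw [Fintype.sum_prod_type, Fintype.sum_prod_type]
    refine Finset.sum_le_sum (fun x _ => ?_)
    by_cases hx : s.rLab x = 0
    · simp only [hx, if_true, true_and]
      have := ht (j - s.bLab x) (by omega)
      unfold UnitStep unitCount at this
      rw [Nat.zero_add, one_mul, Finset.card_filter] at this
      exact this
    · simp only [hx, if_false, false_and, Finset.sum_const_zero, le_refl]
  refine le_trans (Nat.add_le_add h1 h2) ?_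
  rw [← Finset.sum_add_distrib]
  refine Finset.sum_le_sum (fun p _ => ?_)
  split_ifs <;> omega

end Parallel

/-- **the row `i = 0` of the unit-STEP family on every pattern of the grammar, every `j`**:
`Σ_{r = 0 ∧ b ≥ j} b ≤ #{r = 1 ∧ b ≥ j−1}` (with `#{r = 1}` at `j = 0`) -/
theorem unitStep_row_zero : ∀ (s : V2Closure.SP) (j : ℕ), UnitStep s 0 j
  | .free, j => by
    rcases (by omega : j = 0 ∨ j = 1 ∨ 2 ≤ j) with rfl | rfl | h2
    · exact unitStep_zero_zero .free
    · exact (unitStep_offset_one_iff .free 0).2 (unitStep_atom .free (Or.inl rfl) 0 2 le_rfl)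
    · exact unitStep_atom .free (Or.inl rfl) 0 j h2
  | .pin, j => by
    rcases (by omega : j = 0 ∨ j = 1 ∨ 2 ≤ j) with rfl | rfl | h2
    · exact unitStep_zero_zero .pin
    · exact (unitStep_offset_one_iff .pin 0).2 (unitStep_atom .pin (Or.inr (Or.inl rfl)) 0 2 le_rfl)
    · exact unitStep_atom .pin (Or.inr (Or.inl rfl)) 0 j h2
  | .absent, j => by
    rcases (by omega : j = 0 ∨ j = 1 ∨ 2 ≤ j) with rfl | rfl | h2
    · exact unitStep_zero_zero .absent
    · exact (unitStep_offset_one_iff .absent 0).2 (unitStep_atom .absent (Or.inr (Or.inr rfl)) 0 2 le_rfl)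
    · exact unitStep_atom .absent (Or.inr (Or.inr rfl)) 0 j h2
  | .ser s t, j => by
    rcases (by omega : j = 0 ∨ j = 1 ∨ 2 ≤ j) with rfl | rfl | h2
    · exact unitStep_zero_zero (.ser s t)
    · exact (unitStep_offset_one_iff (.ser s t) 0).2
        (unitStep_ser s t 0 2 (unitStep_row_zero s 2) (unitStep_row_zero t 2) (tail_zero_le t 2 (by omega)) (tail_one_le s 2 le_rfl))
    · exact unitStep_ser s t 0 j (unitStep_row_zero s j) (unitStep_row_zero t j) (tail_zero_le t j (by omega)) (tail_one_le s j h2)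
  | .par s t, j =>
    unitCount_par_zero_le s t j (fun l _ => unitStep_row_zero s l) (fun l _ => unitStep_row_zero t l)

/-- **the quantitative row zero**: `j · #{r = 0 ∧ b ≥ j} ≤ #{r = 1 ∧ b ≥ j−1}` on every pattern — the row `i = 0` of
STEP strengthened by the factor `j`, tight on every bundle -/
theorem qstep_row_zero (s : V2Closure.SP) (j : ℕ) :
    j * (Finset.univ.filter (fun y : s.Conf => s.rLab y = 0 ∧ j ≤ s.bLab y)).card
      ≤ (Finset.univ.filter (fun y : s.Conf => s.rLab y = 0 + 1 ∧ j - 1 ≤ s.bLab y)).card := by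
  have h := qstep_of_unitStep s 0 j (unitStep_row_zero s j)
  rwa [Nat.zero_add, one_mul] at h

/-- the unit count form: `Σ_{r = 0 ∧ b ≥ j} b ≤ #{r = 1 ∧ b ≥ j−1}` -/
theorem unitCount_row_zero (s : V2Closure.SP) (j : ℕ) :
    unitCount s 0 j ≤ (Finset.univ.filter (fun y : s.Conf => s.rLab y = 1 ∧ j - 1 ≤ s.bLab y)).card := by
  have h := unitStep_row_zero s j
  unfold UnitStep at h
  rwa [Nat.zero_add, one_mul] at h

end Summit.Ventures.PercRepro2.Tail2D
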